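import Summits.NavierStokesRegularity.TurbBounds.Certs.N1G2.EvalData7
import Summits.NavierStokesRegularity.TurbBounds.CouplingSplit
import Summits.NavierStokesRegularity.TurbBounds.TailN1G2LadderForms
import Summits.NavierStokesRegularity.TurbBounds.TailN1G2Ext
import Summits.NavierStokesRegularity.TurbBounds.QuadFormEval
import HarnessLib

/-!
# Row RB-N1 tail lemma (dim 46) — structured quadratic form of the literal rule piece `TT`, part 14/14 (v2.1: list-level evaluation)
(cell `pub-turb` / `turb-bounds`; v2; GENERATED by pub-turb-cert gen 8 (prover-pub-turb-cert-g8-0) running the gen-7 tool `emit_pieces_v21.py N1G2` from the staged `Certs/N1G2/EvalData*.lean`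
literals; the identity says 'this literal (projected) piece IS the Legendre–Galerkin object of rbsdp SPEC 3.3–3.6 on the kept coordinates'
(LEAN-MAP data item (a) for row RB-N1). Proof: `QuadFormEval.dotProduct_mulVec_eq_rowsEval` turns the quadratic form into a structural
recursion over the row lists (unfolded by `simp only`, linear in the 352 listed entries), then `ring` over the ladder forms.)

HONEST FRAMING: rigorous bounds for the stated PDE and boundary conditions; no claim about physical turbulence beyond the bound.
-/

set_option linter.style.longLine false
set_option linter.style.setOption false
set_option maxRecDepth 100000

noncomputable section

namespace Summit.NavierStokesRegularity.TurbBounds.TailN1G2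

open Finset Matrix Literature.Computation.Certificates
open Summit.NavierStokesRegularity.TurbBounds.LadderTail (w phi lam)
open Summit.NavierStokesRegularity.TurbBounds.CouplingSplit (couplingMode)
open Summit.NavierStokesRegularity.TurbBounds.Certs.N1G2.Evaluator

set_option maxHeartbeats 20000000 in
/-- structured quadratic form of the literal piece `TT` (46×46 kept coordinates, 352 listed / 20 nonzero entries) -/
theorem quadForm_TT (x : Fin 46 → ℝ) :
    x ⬝ᵥ (TT.map (Rat.cast : ℚ → ℝ) *ᵥ x) = (w 17 * eL x 17 ^ 2 + w 18 * eL x 18 ^ 2 + w 19 * eL x 19 ^ 2 + w 20 * eL x 20 ^ 2 + w 21 * eL x 21 ^ 2 + w 22 * eL x 22 ^ 2) + phi 22 * xd x 22 ^ 2 + phi 23 * xd x 23 ^ 2 := by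
  rw [show TT = matrixOfRows 46 46 TT_rows from rfl,
    QuadFormEval.dotProduct_mulVec_eq_rowsEval TT_rows x (ext x) (ext_val x) (ext_zero x)]
  simp only [TT_rows, TT_rows_r0, TT_rows_r1, TT_rows_r2, TT_rows_r3, TT_rows_r4, TT_rows_r5, TT_rows_r6, TT_rows_r7, TT_rows_r8, TT_rows_r9, TT_rows_r10, TT_rows_r11, TT_rows_r12, TT_rows_r13, TT_rows_r14, TT_rows_r15, TT_rows_r16, TT_rows_r17, TT_rows_r18, TT_rows_r19, TT_rows_r20, TT_rows_r21, TT_rows_r22, TT_rows_r23, TT_rows_r24, TT_rows_r25, TT_rows_r26, TT_rows_r27, TT_rows_r28, TT_rows_r29, TT_rows_r30, TT_rows_r31, TT_rows_r32, TT_rows_r33, TT_rows_r34, TT_rows_r35, TT_rows_r36, TT_rows_r37, TT_rows_r38, TT_rows_r39, TT_rows_r40, TT_rows_r41, TT_rows_r42, TT_rows_r43, TT_rows_r44, TT_rows_r45,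
    QuadFormEval.rowsEval_cons, QuadFormEval.rowsEval_nil, QuadFormEval.rowEval_cons, QuadFormEval.rowEval_nil, ext, Rat.cast_zero, zero_mul, mul_zero, zero_add, add_zero,
    eL, xd, w, phi]
  push_cast
  ring

end Summit.NavierStokesRegularity.TurbBounds.TailN1G2

end
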